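import Summits.QuantumFields.YangMills.Theorems.PoincareLipschitzMeanDeviationOfShallowSecondMoment
import Summits.QuantumFields.YangMills.Theorems.UnitScaleGibbsActionDerivativeSlotCalculus
import Literature.MathematicalPhysics.QuantumFieldTheory.Balaban1983to89.T4AxialGaugeSmallField
import HarnessLib

/-!
# LINE 28 «GrossTransfer» — SKELETON v3.3 = v3.2's STUB TEXTS (REGISTERED TEXT: ideator `ym-r3-idea-2` g17 adopts w2-19936 g15's re-line f7b6b7d381eaf46d verbatim — all seven `stub_*` bytes unchanged —
# minus the v3.1 orphan `one_add_log_inv_mul_rpow_le`; WORD-39 (a), 2026-08-29; v3.3 (2026-08-29 late, critic #358c P1 paid): DOCSTRINGS of `stub_linTest`∕`stub_thinRect` made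
# log-free to match the TYPED statements (statements govern; stub bytes UNCHANGED: linTest 8d849bfcc5834644 · thinRect f450bc08afd583b0 · orient a1d2d9ab089ce7a0) + re-stamp record: ✓p749481
# `GrossTransferStubsRestampV32.stub_thinRect`∕`.stub_orient` LANDED BY NAME (prover ym-line-cst-p1 g34); registered `--crux stmt-QuantumFields-23083`; faces landed against these texts: ✓p746660∕✓p747470 `stub_linTest_of_pointwisePackage(')`,
# ✓`UnitScaleGibbsThinRectStub.stub_thinRect_holds'` (no-log), ✓`UnitScaleGibbsAxialGaugeCondSD.stub_condSD`, ✓`GrossTransferStubHessOnEvent.stub_hessOnEvent`, ✓`UnitScaleGibbsBoxPeierlsPolynomial.stub_peierls0`,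
# ✓`UnitScaleGibbsAveragedPlaquetteLawSymmetry.gibbsK_integral_dist1_iterPlaq_eq` (orient); OPEN: `stub_linTest`'s pointwise package (w2 KNIT-E2) and the residual `stub_meanDeviationDeep` = 23134) (v3.1 minus the slack logarithm: `stub_thinRect` and `stub_linTest`'s box∕floor rows WITHOUT `(1 + log β_K)`, per px5 ✓p743434's sharper `C·n∕β` row) (w2-19936 g15, pen of record of `stub_linTest`; PROPOSAL for the line owner ideator ym-r3-idea-2 — NOT registered by me)
# v3 = v2 (5d16c6d70f019e13) with `stub_linTest` RESHAPED (box side `≤ C·L^{cj}·(1+log β_K)`, one displayed weighted thin-rectangle row, floor folded as `n·(1+log β_K)·Σω ≤ C·L^j`)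
# + NEW `stub_thinRect` (RP log-convexity of thin Wilson rectangles, px5 (THIN-RECT)) + the composition re-proved with the extra row; `stub_condSD ∕ stub_hessOnEvent ∕ stub_peierls0 ∕ stub_meanDeviationDeep` TOKEN-IDENTICAL to v2.
# (original v1/v2 header follows)
# LINE 28 «GrossTransfer» — SKELETON v1 (crux idea `Cruxes/HistoryTailL/Ideas/gross-sd-transfer.md`, annexes 1–4; construction C3 «tree-gauge dressing»)

Cell `ym3-torus` (YM ladder rung R3 = continuum SU(2) Yang–Mills on T³ — a RUNG, NOT d = 4, NOT infinite volume, NOT a mass gap, NOT Clay).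
Ideator seat `ym-r3-idea-2` g16, lens «nearmiss».  Crux of record `UnitScaleTilt.HistoryTailL` (stmt-QuantumFields-19936); this line's CONCLUSION BY NAME is
`RevelationMartingale.MeanDeviationL` (stmt-QuantumFields-23083, shared with `PoincareLipschitz.MeanDeviationL`), reached as
  four stubs ⟹ «ShallowFluxSecondMomentL» (the UV-WINDOW second moment, ws-sha16 40ab093fc3808c90; NOT yet an item — mint asked, req10)
            ⟹ `MeanDeviationShallowL` (stmt-QuantumFields-23133) by ✓`meanDeviationShallowL_of_shallowSecondMoment` (px10 g7, ✓p733394)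
  and, with the OPEN crux `MeanDeviationDeepL` (stmt-QuantumFields-23134) imported BY NAME as the fifth stub `stub_meanDeviationDeep` (the RESIDUAL,
  organ-adjacent, NOT this line's mechanism — exactly as LINE 24 imports `SandwichDeep`), ⟹ `MeanDeviationL` (23083): `MeanDeviationL_of_stubs`.

THE NEAR-MISS.  L. Gross's Schwinger–Dyson proof of Gaussian domination for U(1)₃ [GrossCMP1983, Thm 2.2]: along a FIXED Lie-algebra-valued test 1-form `u`,
`β·E[(∂_u A)²] = E[∂_u∂_u A] ≤ ‖du‖²` — the second moment of the flux observable `∂_u A = ⟨du, F⟩` is FREE-FIELD SIZE `‖du‖²/β`, for every `β`, every volume.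
Its measured deficit for SU(2) (annex 1–4, critic #323/#348/#348a): (i) the observable we need — the deviation `dist₁(Ū^j(∂a))` of a BLOCK-AVERAGED plaquette —
is gauge INVARIANT but NOT of the form `∂_u A`; reading it as `∂_u A` on the raw field `U` costs the full 1-form mass `‖u‖² ≍ L^{2j}·‖du‖²` (gauge-variant Hessian);
(ii) the non-abelian Hessian `∂_u∂_u A` is the COVARIANT curl `‖D_U u‖²` plus commutator cross terms.  THE SINGLE INPUT TO IMPROVE (C3): read everything on the
TREE-GAUGE-DRESSED field `V(U) = U^{axialGauge U}` of a box around the plaquette — the Schwinger–Dyson identity survives EXACTLY (adapted directions, Fubini over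
the tree coordinates: `stub_condSD`), the Hessian becomes `‖du‖² + O(nθ)` on the level-0 small-field event (`stub_hessOnEvent`, traceless commutators), the block
plaquette linearises to `Σ_α (∂_{u_α}A)(V)²` with the PINNED curl energy `‖du_α‖² ≤ C·L^j` (`stub_linTest`), and the level-0 large field is a polynomial Peierls
tail (`stub_peierls0`).  Output currency: `E dist₁(Ū^j(∂a))² ≤ C·γ·L^{−(K−j)} = C·L^j/β_K` on the window `N₁·j ≤ K` — the lattice-Maxwell size, NO `p(g)` profile
(hence (Q) and `MeanDeviationShallowL` with room, ✓p733394).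

REGISTRATION.  Written to `Cruxes/HistoryTailL/Lines/gross_transfer.lean` (write slot of 19936); registered `--crux stmt-QuantumFields-23083` (free slot; NEVER on
19936 = LINE 24 / 23133 = LINE 27 / 25567).  PENDING MINT: when director-ym mints the window item (req10), `shallowFluxSecondMomentL_of_stubs` concludes it verbatim and
the line re-registers there.  Stubs are stated over Theorems/Literature/Mathlib declarations ONLY (no workfile-local `def`), so each can be restated and proved in
`Summits/QuantumFields/YangMills/Theorems/*.lean --supports <item>`.  Matrix norms: `open scoped Matrix.Norms.Frobenius` (as px17's `hessianBound`).

HONEST SCOPE.  7 `sorry`s (v3.2: linTest, condSD, hessOnEvent, peierls0, thinRect, orient, meanDeviationDeep), all inside `stub_*`; the composition theorems are kernel-checked modulo the stubs.  NOTHING of the stubs, of «ShallowFluxSecondMomentL»,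
(Q), 23083, 23133, 23134, K1/K2, `HistoryTailL`, the rung R3, d = 4, a continuum limit or a mass gap is proved here; the Yang–Mills mass gap is NOT proved.

References: [GrossCMP1983] L. Gross, CMP 92 (1983) 137–162, Thm 2.2; [Balaban1985UV3] T. Bałaban, CMP 102 (1985) 255–275, (7) p.257, (71) p.273;
[Balaban1985Averaging] CMP 98 (1985) 17–51, (19) p.21; [Chatterjee2019LargeN] S. Chatterjee, CMP 366 (2019) §8; Fröhlich–Israel–Lieb–Simon, CMP 62 (1978) §4.
-/

set_option autoImplicit false

open MeasureTheory
open scoped BigOperators Matrix.Norms.Frobenius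
open Literature.MathematicalPhysics.QuantumFieldTheory.Balaban1983to89
open Literature.MathematicalPhysics.QuantumFieldTheory.Balaban1983to89.T3ContinuumYM3Torus
open Literature.MathematicalPhysics.QuantumFieldTheory.Balaban1983to89.T3UnitScaleTilt
open Literature.MathematicalPhysics.QuantumFieldTheory.Balaban1983to89.T3UnitLawDensityEML (ℰp)
open Literature.MathematicalPhysics.QuantumFieldTheory.Balaban1983to89.T4AxialGaugeSmallField (axialGauge boxPlaqs boxBonds castSite)
open Literature.MathematicalPhysics.QuantumFieldTheory.Balaban1983to89.B7Prop1Explicit (e)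
open Literature.MathematicalPhysics.QuantumFieldTheory.Balaban1983to89.B8Lemma1NonAbelian (lowPart)
open Literature.MathematicalPhysics.QuantumLattice (fundamentalRep)
open Summit.QuantumFields.YangMills.Theorems.UnitScaleGibbsActionDerivativeSlotCalculus (actionDeriv actionDeriv₂ slotBond)
open Summit.QuantumFields.YangMills.Theorems.PoincareLipschitzMeanDeviationOfShallowSecondMoment
  (meanDeviationShallowL_of_shallowSecondMoment meanDeviationL_of_shallowSecondMoment_deep meanDeviationL_of_shallowSecondMoment_deep')

namespace Summit.QuantumFields.YangMills.Cruxes.HistoryTailL.GrossTransfer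

/-! ## §1 The four GrossTransfer stubs (the line's mechanism; the fifth, residual stub is §3) -/

/-- **stub_linTest (L; hardest, = S_lin ⊕ S_test of annex 4 §6).**  DETERMINISTIC LINEARISATION READ ON THE TREE-GAUGE-DRESSED FIELD, INTEGRATED.
For every block size `L`: constants `C, c, N` and `γ₁ ∈ (0,1]` such that for every family `F` (`F.L = L`), `0 < γ ≤ γ₁`, depth `1 ≤ j`, `N·j ≤ K`
and level-`j` plaquette `a` there are a NON-WRAPPING BOX `[lo, hi]` of side `n ≤ C·L^j` and three `𝔰𝔲(2)`-valued TEST FIELDS `u_α` on level-0 bonds,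
supported on INNER, OFF-TREE box bonds (margin 1; `lowPart ≠ 0` = not on the axial tree rooted at `lo`), with the PINNED curl energy
`Σ_p ‖(du_α)_p‖² ≤ C·L^j` (the critical exponent: the averaging weights as a 2-form have `ℓ²`-mass `≍ L^j`) and 1-form mass `Σ_b ‖u_α b‖² ≤ C·L^(c·j)`,
such that the block plaquette deviation is controlled IN MEAN SQUARE by the three Schwinger–Dyson observables `Y_α = (∂_(u_α) A_W)(V(U))`,
`V(U) = U^(axialGauge U lo hi)` (construction C3), up to an error of the TARGET order `C·γ·L^(−(K−j))` and the Gibbs mass of the level-0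
large-field event of the box at the canonical scale `θ_K = (γL^(−K))^(3/8)` (`= β_K^(−3/8)`):
`∫ dist₁(Ū^j(∂a))² ≤ C·Σ_α ∫ Y_α² + C·γL^(−(K−j)) + 4·μ{¬ all box plaquettes θ_K-small}`.
WHY PLAUSIBLE: pointwise on the small-field event, in the axial gauge every box bond is within `2nθ_K` of `1` (✓`dist1_gaugeAct_axialGauge_le_uniform`),
the `j`-fold (0.4) average linearises (px10 S_lin engines ✓p734645/✓p733643/✓p733992) to a GAUGE-INVARIANT linear functional `⟨w, A⟩`, `d*w = 0`, hence
`w = d*h` on the contractible box and `⟨w, A⟩ = ⟨du⁰, dA⟩` for the least-squares potential `u⁰` of `h` (✓p733604 `exists_box_leastSquares_potential`,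
`‖du⁰‖ ≤ ‖h‖ ≍ L^(j/2)`), tree-gauged to vanish on the axial tree; `Y_α` is that functional up to `O(θ²·poly(L^j))`, absorbed by the window `N·j ≤ K`
(`θ_K⁴·L^(2c₁j) = (γL^(−K))^(3/2)L^(2c₁j) ≤ γL^(−(K−j))` once `4c₁j ≤ K`); off the event `dist₁² ≤ 4`.
WHY IT MIGHT FAIL: the linearisation of the `j`-FOLD nonlinear (0.4) average needs small fields at the heights `< j` too — here only level 0 is
constrained (deterministic Stokes inflation `L^(2k)θ_K` at height `k` must stay small: part of the window); the exponents `c, N` are existential for that reason.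
SIZE L.  Sources: [GrossCMP1983] Thm 2.2 (U(1): `Y` IS the flux); [Balaban1985Averaging] (0.4)/(19); annex 4 §0–§2 (C3, windows).
v3 RESHAPE (bus 2026-08-29 NET-FLUX w5 ∕ WITNESS w7 ∕ FINDING §2 w8 ∕ (THIN-RECT) px5 ∕ accounting v2 w2): the pointwise identification of v2 is DEAD
(the net flux `(L²)^j` and, for `(0,μ)`-orientations, the direction-`0` column charges of `linWeight j a` are invisible to every admissible `du`); v3 reads
the block plaquette through the SMOOTHLY CUT-OFF free Coulomb potential `χ·δ₂(G₀∗w)` (lit ✓`LatticeGreenGradient`, ✓`CovariantDischargeTruncatedPotentialPairing`: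
`d(χa) = w − δ₃(χγ) − C₂ + E₁`): the SD observables carry `d(χa)` (pinned energy `≤ 2‖w‖² + collar ≲ L^j`), the Bianchi term carries `χγ`, and the ONE
non-SD row — the smooth collar `σ = E₁ − C₂` (plus, for `(0,μ)`-orientations, the time-spread column charge), `‖σ‖₁ ≍ (L²)^j`, `Σ_b|cobd σ|_b ≍ ‖σ‖₁∕n` —
is reduced ON THE EVENT by ✓`UnitScaleGibbsCollarPairingSecondMoment` (weighted Cauchy–Schwarz) to the displayed weighted sum of DRESSED-BOND second
moments `Σ_b ω_b·∫dist₁((VU) b)²`, `ω ≥ 0` on box bonds, with the FLOOR folded LOG-FREE as `n·Σ_b ω_b ≤ C·L^j` (true for `n ≍ L^{3j}`, `Σω ≍ L^{4j}∕n²`)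
— exactly as TYPED below; the box side is `≤ C·L^{cj}` (no `log β_K` anywhere: the thin-rectangle row is log-free via ✓`UnitScaleGibbsPlaquetteSecondMoment`,
see `stub_thinRect`; v3.2, critic #358c P1) and `2n + 6 ≤ sitesPerDir 0` (the RP rectangle fits).  `stub_thinRect` cashes the displayed row at PERIMETER size. -/
theorem stub_linTest :
    ∀ (L : ℕ), ∃ (C : ℝ) (c N : ℕ), 0 ≤ C ∧ 0 < N ∧ ∃ γ₁ : ℝ, 0 < γ₁ ∧ γ₁ ≤ 1 ∧
        ∀ (F : T3Family) (γ : ℝ), F.L = L → 0 < γ → γ ≤ γ₁ → ∀ (K j : ℕ), 1 ≤ j → N * j ≤ K →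
          ∀ a : Plaq (F.P K) j, a.μ.val = 1 → a.ν.val = 2 →
            ∃ (lo hi : Fin (F.P K).d → ℤ) (n : ℕ) (u : Fin 3 → PBond (F.P K) 0 → Matrix (Fin 2) (Fin 2) ℂ)
              (ω : PBond (F.P K) 0 → ℝ),
              (∀ κ, lo κ ≤ hi κ ∧ hi κ ≤ lo κ + n) ∧ 2 * n + 6 ≤ (F.P K).sitesPerDir 0 ∧
              (∀ α b, star (u α b) = -(u α b) ∧ (u α b).trace = 0) ∧
              (∀ α b, u α b ≠ 0 → ∃ x : Fin (F.P K).d → ℤ,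
                  lo + 1 ≤ x ∧ x + e b.dir + 1 ≤ hi ∧ b.src = castSite x ∧ lowPart b.dir (x - lo) ≠ 0) ∧
              (n : ℝ) ≤ C * (L : ℝ) ^ (c * j) ∧
              (∀ α, ∑ p : Plaq (F.P K) 0, ‖u α (slotBond p 0) + u α (slotBond p 1) - u α (slotBond p 2) - u α (slotBond p 3)‖ ^ 2 ≤ C * (L : ℝ) ^ j) ∧
              (∀ α, ∑ b : PBond (F.P K) 0, ‖u α b‖ ^ 2 ≤ C * (L : ℝ) ^ (c * j)) ∧
              (∀ b, 0 ≤ ω b) ∧ (∀ b, ω b ≠ 0 → b ∈ (boxBonds lo hi : Set (PBond (F.P K) 0))) ∧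
              (n : ℝ) * ∑ b : PBond (F.P K) 0, ω b ≤ C * (L : ℝ) ^ j ∧
              ∫ U, (GaugeGroup.dist1 (GaugeField.plaqHol
                  (Averaging.iter (fun i' => BlockAveraging.blockAvg (P := F.P K) (j := i') ℰp) j U) a)) ^ 2 ∂(gibbsK F ℰp γ K)
                ≤ C * ∑ α, ∫ U, (actionDeriv (fundamentalRep (Fin 2)) (u α) (GaugeField.gaugeAct (axialGauge U lo hi) U)) ^ 2 ∂(gibbsK F ℰp γ K)
                  + ∑ b : PBond (F.P K) 0, ω b *
                      ∫ U, (GaugeGroup.dist1 (GaugeField.gaugeAct (axialGauge U lo hi) U b)) ^ 2 ∂(gibbsK F ℰp γ K)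
                  + C * (γ * ((L : ℝ)⁻¹) ^ (K - j))
                  + 4 * (gibbsK F ℰp γ K).real {U | ¬ PlaqSmallOn (boxPlaqs lo hi) ((γ * ((L : ℝ)⁻¹) ^ K) ^ ((3 : ℝ) / 8)) U} := by
  sorry

/-- **stub_condSD (M).**  THE SECOND-ORDER SCHWINGER–DYSON («ENERGY») IDENTITY IN THE TREE-GAUGE DRESSING (construction C3, critic #348a (2)):
for `u` skew-Hermitian traceless, supported on inner OFF-TREE bonds of a non-wrapping box, and `V(U) = U^(axialGauge U lo hi)`:
`β_K · ∫ (∂_u A_W)(V U)² dμ_K = ∫ (∂_u ∂_u A_W)(V U) dμ_K` — EXACT, every `γ ≥ 0`, every `K`, no window, no small field.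
MECHANISM: flow each off-tree bond `b ∈ supp u` along the ADAPTED direction `W_b(U) = Ad(g_(x_b)(U)⁻¹) u_b`, `g = axialGauge U lo hi` a measurable
function of the TREE-bond variables only (so `W_b` is constant along its own flow: Fubini over the product Haar measure = ✓p734... `UnitScaleGibbsOneBondSchwingerDysonAdapted.
integral_shiftDeriv_eq_gibbsMeasure_adapted`, px8 g9); under it `V ↦ V[b ↦ e^(t u_b) V_b]`, and `A_W(U) = A_W(V U)` (gauge invariance), so the one-bond identity
`∫ ∂_b f = β ∫ f · ∂_b A_W` with `f = (∂_u A_W) ∘ V` reads `∫ (oneBondDeriv₂ u b)(V U) = β ∫ (∂_u A_W)(V U) · (oneBondDeriv u b)(V U)`; summing over all bonds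
(terms with `u_b = 0` vanish: ✓`word_update_zero`) gives the display (`Σ_b oneBondDeriv = actionDeriv`, `Σ_b oneBondDeriv₂ = actionDeriv₂`, px17 slot calculus).
WHY IT MIGHT FAIL: only bookkeeping can — the rows «`V` is measurable/continuous on non-wrapping boxes» (`axialGauge = axialFn ∘ pull`, a finite product) and the
derivative of `Y ∘ V` along the adapted flow; Gross's divergence term is `≡ 0` by construction (left-invariant fields are Haar-divergence-free).  SIZE M.
Sources: [GrossCMP1983] (2.7)–(2.9); [Chatterjee2019LargeN] §8; annex 4 §0 (a)–(c). -/
theorem stub_condSD :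
    ∀ (F : T3Family) (γ : ℝ), 0 ≤ γ → ∀ (K : ℕ) (lo hi : Fin (F.P K).d → ℤ) (n : ℕ)
          (u : PBond (F.P K) 0 → Matrix (Fin 2) (Fin 2) ℂ),
          (∀ κ, lo κ ≤ hi κ ∧ hi κ ≤ lo κ + n) → n < (F.P K).sitesPerDir 0 →
          (∀ b, star (u b) = -(u b) ∧ (u b).trace = 0) →
          (∀ b, u b ≠ 0 → ∃ x : Fin (F.P K).d → ℤ,
              lo + 1 ≤ x ∧ x + e b.dir + 1 ≤ hi ∧ b.src = castSite x ∧ lowPart b.dir (x - lo) ≠ 0) →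
          (F.scheme ℰp γ).β K *
              ∫ U, (actionDeriv (fundamentalRep (Fin 2)) u (GaugeField.gaugeAct (axialGauge U lo hi) U)) ^ 2 ∂(gibbsK F ℰp γ K)
            = ∫ U, actionDeriv₂ (fundamentalRep (Fin 2)) u (GaugeField.gaugeAct (axialGauge U lo hi) U) ∂(gibbsK F ℰp γ K) := by
  sorry

/-- **stub_hessOnEvent (S–M; residual non-abelian crux (A) of the card, bricks (A2) ✓`PlaquetteHessianCovariantCurl` w2 g14, global bound px17).**
THE EXPECTED HESSIAN IN THE DRESSED GAUGE IS THE CURL ENERGY up to small-field corrections and the large-field mass: an ABSOLUTE constant `C`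
(`d = 3`, `N = 2`) with, for every box/test field as in `stub_condSD` and EVERY `θ > 0`,
`∫ (∂_u∂_u A_W)(V U) dμ_K ≤ C·Σ_p ‖(du)_p‖² + C·(n+1)²(θ + θ²)·Σ_b ‖u_b‖² + C·(Σ_b ‖u_b‖²)·μ_K{¬ all box plaquettes θ-small}`.
MECHANISM: pointwise ON the event, per plaquette `Hess_p = N⁻¹‖(D_V u)_p‖²_HS + ρ_p`, `|ρ_p| ≤ 2·dist₁(V(∂p))·(Σ_i ‖u_(b_i)‖)²` (the non-abelian cross terms are
COMMUTATORS, traceless: ✓`hessianReading_le`), and `(D_V u)_p = (du)_p + O(nθ·Σ_i‖u_(b_i)‖)` because every box bond of `V` is within `2nθ` of `1`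
(✓`dist1_gaugeAct_axialGauge_le_uniform`; plaquettes meeting `supp u` are box plaquettes by the margin); OFF the event the crude global bound
`|Hess| ≤ 16·Σ_p(Σ_i‖u_(b_i)‖)² ≤ C·Σ_b‖u_b‖²` (px17 `hessianBound`); integrate (`μ_K` a probability measure).
WHY IT MIGHT FAIL: norm bookkeeping only (operator vs Frobenius vs Hilbert–Schmidt on `M₂(ℂ)`: absolute constants); the on-event reading needs ALL FOUR bonds of every
plaquette meeting `supp u` inside the box — supplied by the margin-1 support hypothesis.  SIZE S–M.  Sources: [GrossCMP1983] proof of Thm 2.2 p.143; annex 4 §2 row (A). -/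
theorem stub_hessOnEvent :
    ∃ C : ℝ, 0 ≤ C ∧ ∀ (F : T3Family) (γ : ℝ), 0 ≤ γ → ∀ (K : ℕ) (lo hi : Fin (F.P K).d → ℤ) (n : ℕ)
          (u : PBond (F.P K) 0 → Matrix (Fin 2) (Fin 2) ℂ),
          (∀ κ, lo κ ≤ hi κ ∧ hi κ ≤ lo κ + n) → n < (F.P K).sitesPerDir 0 →
          (∀ b, star (u b) = -(u b) ∧ (u b).trace = 0) →
          (∀ b, u b ≠ 0 → ∃ x : Fin (F.P K).d → ℤ,
              lo + 1 ≤ x ∧ x + e b.dir + 1 ≤ hi ∧ b.src = castSite x ∧ lowPart b.dir (x - lo) ≠ 0) →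
          ∀ θ : ℝ, 0 < θ →
            ∫ U, actionDeriv₂ (fundamentalRep (Fin 2)) u (GaugeField.gaugeAct (axialGauge U lo hi) U) ∂(gibbsK F ℰp γ K)
              ≤ C * ∑ p : Plaq (F.P K) 0, ‖u (slotBond p 0) + u (slotBond p 1) - u (slotBond p 2) - u (slotBond p 3)‖ ^ 2
                + C * ((n : ℝ) + 1) ^ 2 * (θ + θ ^ 2) * ∑ b : PBond (F.P K) 0, ‖u b‖ ^ 2
                + C * (∑ b : PBond (F.P K) 0, ‖u b‖ ^ 2)
                    * (gibbsK F ℰp γ K).real {U | ¬ PlaqSmallOn (boxPlaqs lo hi) θ U} := by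
  sorry

/-- **stub_peierls0 (S–M; honest new input (E) of annex 4).**  LEVEL-0 PEIERLS FOR `gibbsK` ON T³ AT THE CANONICAL SCALE, POLYNOMIAL FORM (R-128 compliant:
it binds `gibbsK`'s own `(F, γ, K, β_K = L^K/γ)` telescope): for every `L` and every moment order `M` there are `C` and `γ₁ ∈ (0,1]` with
`μ_K{some plaquette of the box [lo,hi] has dist₁(U(∂p)) ≥ θ_K} ≤ C·(n+1)³·(γL^(−K))^M`, `θ_K = (γL^(−K))^(3/8) = β_K^(−3/8)`.
MECHANISM: union bound over the `≤ 3(n+1)³` box plaquettes × the single-plaquette chessboard/RP estimate `μ_K{dist₁(U(∂p)) ≥ θ} ≤ C'β^c'·e^(−cβθ²)`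
(d = 4 template ✓`BalabanUVNodesN20LCSAtRecordLevelZero.gibbsMeasure_largeField_le`; T³ kits `chessboardRP_T3` p481363 / `chessboardInsertion_T3`; even side
`2L^(m+K)`), at `βθ_K² = β_K^(1/4)`: `e^(−cβ^(1/4))·poly(β) ≤ C_M β^(−M)`.
WHY IT MIGHT FAIL: the RP/chessboard single-plaquette bound on T³ for SU(2) Wilson must be uniform in the volume `(2L^(m+K))³` with the entropy factor
polynomial in `β` (free-energy lower bound by a `β^(−1/2)`-ball) — standard but not yet in the tree for d = 3.  SIZE S–M.
Sources: [Balaban1985UV3] (71) p.273 (large-field factors `e^(−p(g)²/4)`); Fröhlich–Israel–Lieb–Simon CMP 62 (1978) §4 (chessboard); annex 4 §2 row (E). -/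
theorem stub_peierls0 :
    ∀ (L M : ℕ), ∃ C : ℝ, 0 ≤ C ∧ ∃ γ₁ : ℝ, 0 < γ₁ ∧ γ₁ ≤ 1 ∧
        ∀ (F : T3Family) (γ : ℝ), F.L = L → 0 < γ → γ ≤ γ₁ → ∀ (K : ℕ) (lo hi : Fin (F.P K).d → ℤ) (n : ℕ),
          (∀ κ, lo κ ≤ hi κ ∧ hi κ ≤ lo κ + n) → n < (F.P K).sitesPerDir 0 →
          (gibbsK F ℰp γ K).real {U | ¬ PlaqSmallOn (boxPlaqs lo hi) ((γ * ((L : ℝ)⁻¹) ^ K) ^ ((3 : ℝ) / 8)) U}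
            ≤ C * ((n : ℝ) + 1) ^ 3 * (γ * ((L : ℝ)⁻¹) ^ K) ^ M := by
  sorry

/-- **stub_thinRect (S–M; NEW in v3 — the reflection-positivity input; pen px5 g10 (THIN-RECT) + the ladder dictionary).**  THE PERIMETER-LAW SECOND
MOMENT OF DRESSED BONDS: for every `L` there are `C` and `γ₁ ∈ (0,1]` such that for every non-wrapping box `[lo,hi]` of side `n` with `2n + 6 ≤ sitesPerDir 0`
and every box bond `b`, `∫ dist₁((U^{axialGauge U lo hi}) b)² dμ_K ≤ C·n·β_K⁻¹` (`β_K⁻¹ = γL^{−K}`; LOG-FREE, exactly as typed — LANDED token-identically as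
✓`UnitScaleGibbsThinRectStub.stub_thinRect_holds'` (p746963; re-stamped BY NAME ✓p749481 `GrossTransferStubsRestampV32.stub_thinRect`); the log-carrying variant is ✓`stub_thinRect_holds`).
MECHANISM: the dressed bond is a conjugated comb LADDER (lit ✓`B8Lemma1NonAbelian.axial_bond_eq_sharp`), a product of ≤ 2 straight thin `r×1`
Wilson rectangles (`r ≤ n`); `‖W − 1‖² ≤ 2N(1 − N⁻¹Re tr W)`; RP log-convexity of `r ↦ ⟨W_{r×1}⟩` (lit ✓`StringTension.wilsonExpectation_wilsonLoop_sq_le`,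
Osterwalder–Seiler) + Bernoulli ⇒ `1 − ⟨W_{r×1}⟩ ≤ (4r − 3)·⟨1 − W_{1×1}⟩`; the single-plaquette mean `⟨1 − W_{1×1}⟩ ≤ C∕β` for `β ≥ 8` (log-free:
✓`UnitScaleGibbsPlaquetteSecondMoment`, from the tree's uniform Gaussian tail).  WHY IT MIGHT FAIL: only bookkeeping (torus parity∕position of the RP planes; the `GibbsMeasureWilsonDictionary` transfer).
SIZE S–M.  Sources: Seiler, LNP 159 (1982) §2; [Balaban1985Averaging] pp. 24–25. -/
theorem stub_thinRect :
    ∀ (L : ℕ), ∃ C : ℝ, 0 ≤ C ∧ ∃ γ₁ : ℝ, 0 < γ₁ ∧ γ₁ ≤ 1 ∧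
        ∀ (F : T3Family) (γ : ℝ), F.L = L → 0 < γ → γ ≤ γ₁ → ∀ (K : ℕ) (lo hi : Fin (F.P K).d → ℤ) (n : ℕ),
          (∀ κ, lo κ ≤ hi κ ∧ hi κ ≤ lo κ + n) → 2 * n + 6 ≤ (F.P K).sitesPerDir 0 →
          ∀ b : PBond (F.P K) 0, b ∈ (boxBonds lo hi : Set (PBond (F.P K) 0)) →
            ∫ U, (GaugeGroup.dist1 (GaugeField.gaugeAct (axialGauge U lo hi) U b)) ^ 2 ∂(gibbsK F ℰp γ K)
              ≤ C * n * (γ * ((L : ℝ)⁻¹) ^ K) := by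
  sorry

/-- **stub_orient (S; NEW in v3.1 — the ORIENTATION REDUCTION; pen w3-19936 g18 (ORIENT) `UnitScaleGibbsAveragedPlaquetteLawSymmetry.gibbsK_integral_dist1_iterPlaq_eq`,
closable BY NAME).**  THE LAW OF `dist₁(Ū^j(∂p))` UNDER `gibbsK` DOES NOT DEPEND ON THE LEVEL-`j` PLAQUETTE `p`: for every `φ`,
`∫ φ(dist₁(Ū^j(∂p))) dμ_K = ∫ φ(dist₁(Ū^j(∂q))) dμ_K` (permutation and block-translation invariance of the Wilson Gibbs law + equivariance of the (0.4) tower,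
lit ✓`T4Continuum.iter_permute` ∕ ✓`blockAvg_permute` ∕ ✓`TorusHypercubicSymmetry`).  It lets `stub_linTest` be displayed for the REFERENCE plaquettes
`⟨x; 1, 2⟩` only (orientation transverse to the comb's direction `0`, where the cutoff Coulomb potential is off-tree with no column-charge correction). [cite: Balaban1985UV3, (1)-(3) p.256] -/
theorem stub_orient :
    ∀ (F : T3Family) (γ : ℝ), 0 ≤ γ → ∀ (K j : ℕ) (p q : Plaq (F.P K) j) (φ : ℝ → ℝ),
      ∫ U, φ (GaugeGroup.dist1 (GaugeField.plaqHol (Averaging.iter (fun i' => BlockAveraging.blockAvg (P := F.P K) (j := i') ℰp) j U) p))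
          ∂(gibbsK F ℰp γ K) =
        ∫ U, φ (GaugeGroup.dist1 (GaugeField.plaqHol (Averaging.iter (fun i' => BlockAveraging.blockAvg (P := F.P K) (j := i') ℰp) j U) q))
          ∂(gibbsK F ℰp γ K) := by
  sorry

/-! ## §2 The kernel-checked composition: six stubs ⇒ «ShallowFluxSecondMomentL» ⇒ `MeanDeviationShallowL` -/

set_option maxHeartbeats 1600000 in
/-- ★★★ **COMPOSITION v3.1 (sorry-free): the six stubs ⇒ the UV-window second moment «ShallowFluxSecondMomentL»** (ws-sha16 40ab093fc3808c90, the `hSh`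
binder of ✓`PoincareLipschitzMeanDeviationOfShallowSecondMoment`).  Window arithmetic in `y = (γL^{−K})^{1∕16}` (`θ_K = y⁶`, `γL^{−K} = y¹⁶`;
LOG-FREE since v3.2: the former log factor is the constant `ℓ := 1`, the absorption rows `ℓ·y ≤ 17`, `ℓ²θ_K ≤ 289y⁴`, `ℓ³x^{c+5} ≤ 4913x^{c+4}` kept at `ℓ = 1`):
`N₁ = max N (12c + 16)`, Peierls order `M = c + 5`, `γ₁ = min`; the six terms (curl energy · β⁻¹; small-field Hessian corrections `L^{3cj}θ_K ≤ 289y⁴`-window;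
Hessian × tail; the weighted thin-rectangle row `Σ_b ω_b·C₅nβ_K⁻¹ ≤ C₁C₅·L^jβ_K⁻¹` by the folded floor `n·Σω ≤ C₁·L^j`;
linearisation remainder; `4·tail`) are each `≤ const·γL^{−(K−j)}`. [cite: GrossCMP1983, Thm 2.2] -/
theorem shallowFluxSecondMomentL_of
    (h1 : ∀ (L : ℕ), ∃ (C : ℝ) (c N : ℕ), 0 ≤ C ∧ 0 < N ∧ ∃ γ₁ : ℝ, 0 < γ₁ ∧ γ₁ ≤ 1 ∧
          ∀ (F : T3Family) (γ : ℝ), F.L = L → 0 < γ → γ ≤ γ₁ → ∀ (K j : ℕ), 1 ≤ j → N * j ≤ K →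
            ∀ a : Plaq (F.P K) j, a.μ.val = 1 → a.ν.val = 2 →
              ∃ (lo hi : Fin (F.P K).d → ℤ) (n : ℕ) (u : Fin 3 → PBond (F.P K) 0 → Matrix (Fin 2) (Fin 2) ℂ)
                (ω : PBond (F.P K) 0 → ℝ),
                (∀ κ, lo κ ≤ hi κ ∧ hi κ ≤ lo κ + n) ∧ 2 * n + 6 ≤ (F.P K).sitesPerDir 0 ∧
                (∀ α b, star (u α b) = -(u α b) ∧ (u α b).trace = 0) ∧
                (∀ α b, u α b ≠ 0 → ∃ x : Fin (F.P K).d → ℤ,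
                    lo + 1 ≤ x ∧ x + e b.dir + 1 ≤ hi ∧ b.src = castSite x ∧ lowPart b.dir (x - lo) ≠ 0) ∧
                (n : ℝ) ≤ C * (L : ℝ) ^ (c * j) ∧
                (∀ α, ∑ p : Plaq (F.P K) 0, ‖u α (slotBond p 0) + u α (slotBond p 1) - u α (slotBond p 2) - u α (slotBond p 3)‖ ^ 2 ≤ C * (L : ℝ) ^ j) ∧
                (∀ α, ∑ b : PBond (F.P K) 0, ‖u α b‖ ^ 2 ≤ C * (L : ℝ) ^ (c * j)) ∧
                (∀ b, 0 ≤ ω b) ∧ (∀ b, ω b ≠ 0 → b ∈ (boxBonds lo hi : Set (PBond (F.P K) 0))) ∧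
                (n : ℝ) * ∑ b : PBond (F.P K) 0, ω b ≤ C * (L : ℝ) ^ j ∧
                ∫ U, (GaugeGroup.dist1 (GaugeField.plaqHol
                    (Averaging.iter (fun i' => BlockAveraging.blockAvg (P := F.P K) (j := i') ℰp) j U) a)) ^ 2 ∂(gibbsK F ℰp γ K)
                  ≤ C * ∑ α, ∫ U, (actionDeriv (fundamentalRep (Fin 2)) (u α) (GaugeField.gaugeAct (axialGauge U lo hi) U)) ^ 2 ∂(gibbsK F ℰp γ K)
                    + ∑ b : PBond (F.P K) 0, ω b *
                        ∫ U, (GaugeGroup.dist1 (GaugeField.gaugeAct (axialGauge U lo hi) U b)) ^ 2 ∂(gibbsK F ℰp γ K)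
                    + C * (γ * ((L : ℝ)⁻¹) ^ (K - j))
                    + 4 * (gibbsK F ℰp γ K).real {U | ¬ PlaqSmallOn (boxPlaqs lo hi) ((γ * ((L : ℝ)⁻¹) ^ K) ^ ((3 : ℝ) / 8)) U})
    (h2 : ∀ (F : T3Family) (γ : ℝ), 0 ≤ γ → ∀ (K : ℕ) (lo hi : Fin (F.P K).d → ℤ) (n : ℕ)
            (u : PBond (F.P K) 0 → Matrix (Fin 2) (Fin 2) ℂ),
            (∀ κ, lo κ ≤ hi κ ∧ hi κ ≤ lo κ + n) → n < (F.P K).sitesPerDir 0 →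
            (∀ b, star (u b) = -(u b) ∧ (u b).trace = 0) →
            (∀ b, u b ≠ 0 → ∃ x : Fin (F.P K).d → ℤ,
                lo + 1 ≤ x ∧ x + e b.dir + 1 ≤ hi ∧ b.src = castSite x ∧ lowPart b.dir (x - lo) ≠ 0) →
            (F.scheme ℰp γ).β K *
                ∫ U, (actionDeriv (fundamentalRep (Fin 2)) u (GaugeField.gaugeAct (axialGauge U lo hi) U)) ^ 2 ∂(gibbsK F ℰp γ K)
              = ∫ U, actionDeriv₂ (fundamentalRep (Fin 2)) u (GaugeField.gaugeAct (axialGauge U lo hi) U) ∂(gibbsK F ℰp γ K))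
    (h3 : ∃ C : ℝ, 0 ≤ C ∧ ∀ (F : T3Family) (γ : ℝ), 0 ≤ γ → ∀ (K : ℕ) (lo hi : Fin (F.P K).d → ℤ) (n : ℕ)
            (u : PBond (F.P K) 0 → Matrix (Fin 2) (Fin 2) ℂ),
            (∀ κ, lo κ ≤ hi κ ∧ hi κ ≤ lo κ + n) → n < (F.P K).sitesPerDir 0 →
            (∀ b, star (u b) = -(u b) ∧ (u b).trace = 0) →
            (∀ b, u b ≠ 0 → ∃ x : Fin (F.P K).d → ℤ,
                lo + 1 ≤ x ∧ x + e b.dir + 1 ≤ hi ∧ b.src = castSite x ∧ lowPart b.dir (x - lo) ≠ 0) →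
            ∀ θ : ℝ, 0 < θ →
              ∫ U, actionDeriv₂ (fundamentalRep (Fin 2)) u (GaugeField.gaugeAct (axialGauge U lo hi) U) ∂(gibbsK F ℰp γ K)
                ≤ C * ∑ p : Plaq (F.P K) 0, ‖u (slotBond p 0) + u (slotBond p 1) - u (slotBond p 2) - u (slotBond p 3)‖ ^ 2
                  + C * ((n : ℝ) + 1) ^ 2 * (θ + θ ^ 2) * ∑ b : PBond (F.P K) 0, ‖u b‖ ^ 2
                  + C * (∑ b : PBond (F.P K) 0, ‖u b‖ ^ 2)
                      * (gibbsK F ℰp γ K).real {U | ¬ PlaqSmallOn (boxPlaqs lo hi) θ U})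
    (h4 : ∀ (L M : ℕ), ∃ C : ℝ, 0 ≤ C ∧ ∃ γ₁ : ℝ, 0 < γ₁ ∧ γ₁ ≤ 1 ∧
          ∀ (F : T3Family) (γ : ℝ), F.L = L → 0 < γ → γ ≤ γ₁ → ∀ (K : ℕ) (lo hi : Fin (F.P K).d → ℤ) (n : ℕ),
            (∀ κ, lo κ ≤ hi κ ∧ hi κ ≤ lo κ + n) → n < (F.P K).sitesPerDir 0 →
            (gibbsK F ℰp γ K).real {U | ¬ PlaqSmallOn (boxPlaqs lo hi) ((γ * ((L : ℝ)⁻¹) ^ K) ^ ((3 : ℝ) / 8)) U}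
              ≤ C * ((n : ℝ) + 1) ^ 3 * (γ * ((L : ℝ)⁻¹) ^ K) ^ M)
    (h5 : ∀ (L : ℕ), ∃ C : ℝ, 0 ≤ C ∧ ∃ γ₁ : ℝ, 0 < γ₁ ∧ γ₁ ≤ 1 ∧
          ∀ (F : T3Family) (γ : ℝ), F.L = L → 0 < γ → γ ≤ γ₁ → ∀ (K : ℕ) (lo hi : Fin (F.P K).d → ℤ) (n : ℕ),
            (∀ κ, lo κ ≤ hi κ ∧ hi κ ≤ lo κ + n) → 2 * n + 6 ≤ (F.P K).sitesPerDir 0 →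
            ∀ b : PBond (F.P K) 0, b ∈ (boxBonds lo hi : Set (PBond (F.P K) 0)) →
              ∫ U, (GaugeGroup.dist1 (GaugeField.gaugeAct (axialGauge U lo hi) U b)) ^ 2 ∂(gibbsK F ℰp γ K)
                ≤ C * n * (γ * ((L : ℝ)⁻¹) ^ K))
    (h6 : ∀ (F : T3Family) (γ : ℝ), 0 ≤ γ → ∀ (K j : ℕ) (p q : Plaq (F.P K) j) (φ : ℝ → ℝ),
          ∫ U, φ (GaugeGroup.dist1 (GaugeField.plaqHol (Averaging.iter (fun i' => BlockAveraging.blockAvg (P := F.P K) (j := i') ℰp) j U) p))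
              ∂(gibbsK F ℰp γ K) =
            ∫ U, φ (GaugeGroup.dist1 (GaugeField.plaqHol (Averaging.iter (fun i' => BlockAveraging.blockAvg (P := F.P K) (j := i') ℰp) j U) q))
              ∂(gibbsK F ℰp γ K)) :
    ∀ (L : ℕ), ∃ N₁ : ℕ, 0 < N₁ ∧ ∃ C : ℝ, 0 ≤ C ∧ ∃ γ₁ : ℝ, 0 < γ₁ ∧ γ₁ ≤ 1 ∧
          ∀ (F : T3Family) (γ : ℝ), F.L = L → 0 < γ → γ ≤ γ₁ → ∀ (K j : ℕ), 1 ≤ j → N₁ * j ≤ K →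
            ∀ a : Plaq (F.P K) j,
              ∫ U, (GaugeGroup.dist1 (GaugeField.plaqHol
                  (Averaging.iter (fun i' => BlockAveraging.blockAvg (P := F.P K) (j := i') ℰp) j U) a)) ^ 2 ∂(gibbsK F ℰp γ K)
                ≤ C * (γ * ((F.L : ℝ)⁻¹) ^ (K - j)) := by
  classical
  intro L
  obtain ⟨C₁, c, N, hC₁, hN, γa, hγa, hγa1, H1⟩ := h1 L
  obtain ⟨C₃, hC₃, H3⟩ := h3
  obtain ⟨C₄, hC₄, γb, hγb, hγb1, H4⟩ := h4 L (c + 5)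
  obtain ⟨C₅, hC₅, γc, hγc, hγc1, H5⟩ := h5 L
  -- the Hessian-side constant (per colour component) and the total constant
  set KH : ℝ := C₃ * C₁ + C₃ * (578 * C₁ * (C₁ + 1) ^ 2) + C₃ * (4913 * C₁ * C₄ * (C₁ + 1) ^ 3) with hKH
  refine ⟨max N (12 * c + 16), Nat.lt_of_lt_of_le hN (le_max_left _ _),
    3 * C₁ * KH + C₅ * C₁ + C₁ + 4 * (4913 * C₄ * (C₁ + 1) ^ 3), by positivity,
    min γa (min γb γc), lt_min hγa (lt_min hγb hγc), (min_le_left _ _).trans hγa1, ?_⟩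
  intro F γ hFL hγ hγle K j hj hNj a
  subst hFL
  have hγa' : γ ≤ γa := hγle.trans (min_le_left _ _)
  have hγb' : γ ≤ γb := hγle.trans ((min_le_right _ _).trans (min_le_left _ _))
  have hγc' : γ ≤ γc := hγle.trans ((min_le_right _ _).trans (min_le_right _ _))
  have hγ1 : γ ≤ 1 := hγa'.trans hγa1
  have hNj' : N * j ≤ K := le_trans (Nat.mul_le_mul_right j (le_max_left _ _)) hNj
  have hcj : (12 * c + 16) * j ≤ K := le_trans (Nat.mul_le_mul_right j (le_max_right N _)) hNj
  have hjK : j ≤ K := le_trans (Nat.le_mul_of_pos_left j hN) hNj'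
  -- the reference plaquette of orientation `(1,2)` at `a`'s corner, its box, test fields, weights and integrated linearisation
  have hd3 : (F.P K).d = 3 := rfl
  let q : Plaq (F.P K) j := ⟨a.src, ⟨1, by rw [hd3]; norm_num⟩, ⟨2, by rw [hd3]; norm_num⟩, Fin.mk_lt_mk.mpr (by norm_num)⟩
  obtain ⟨lo, hi, n, u, ω, hbox, hn6, hsu, hsupp, hnC, hD, hS, hω0, hωsupp, hfloor, hlin⟩ := H1 F γ rfl hγ hγa' K j hj hNj' q rfl rfl
  have horient : ∫ U, (GaugeGroup.dist1 (GaugeField.plaqHol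
        (Averaging.iter (fun i' => BlockAveraging.blockAvg (P := F.P K) (j := i') ℰp) j U) a)) ^ 2 ∂(gibbsK F ℰp γ K) =
      ∫ U, (GaugeGroup.dist1 (GaugeField.plaqHol
        (Averaging.iter (fun i' => BlockAveraging.blockAvg (P := F.P K) (j := i') ℰp) j U) q)) ^ 2 ∂(gibbsK F ℰp γ K) :=
    h6 F γ hγ.le K j a q (fun t => t ^ 2)
  have hn : n < (F.P K).sitesPerDir 0 := by omega
  -- basic real facts
  have hL1 : (1 : ℝ) ≤ (F.L : ℝ) := by exact_mod_cast F.hL.2.le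
  have hL0 : (0 : ℝ) < (F.L : ℝ) := by linarith
  have hX0 : 0 < (γ * ((F.L : ℝ)⁻¹) ^ K) := by positivity
  have hXle : (γ * ((F.L : ℝ)⁻¹) ^ K) ≤ ((F.L : ℝ)⁻¹) ^ K := by
    calc (γ * ((F.L : ℝ)⁻¹) ^ K) ≤ 1 * ((F.L : ℝ)⁻¹) ^ K := by gcongr
    _ = ((F.L : ℝ)⁻¹) ^ K := one_mul _
  have hX1 : (γ * ((F.L : ℝ)⁻¹) ^ K) ≤ 1 := hXle.trans (pow_le_one₀ (by positivity) (inv_le_one_of_one_le₀ hL1))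
  -- the sixteenth root `y` of `x = γL^{-K}`: `θ_K = y⁶`, `x = y¹⁶`; log-free since v3.2: `ℓ := 1`, so `ℓ·y ≤ 17` trivially
  set x : ℝ := γ * ((F.L : ℝ)⁻¹) ^ K with hx
  set y : ℝ := x ^ ((1 : ℝ) / 16) with hy
  set ℓ : ℝ := (1 : ℝ) with hℓ
  have hy0 : 0 < y := Real.rpow_pos_of_pos hX0 _
  have hy1 : y ≤ 1 := Real.rpow_le_one hX0.le hX1 (by norm_num)
  have hy16 : y ^ 16 = x := by
    rw [hy, ← Real.rpow_natCast _ 16, ← Real.rpow_mul hX0.le]; norm_num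
  have hθy : x ^ ((3 : ℝ) / 8) = y ^ 6 := by
    rw [hy, ← Real.rpow_natCast _ 6, ← Real.rpow_mul hX0.le]; norm_num
  have hℓ1 : 1 ≤ ℓ := le_rfl
  have hℓ0 : 0 ≤ ℓ := zero_le_one.trans hℓ1
  have hℓy : ℓ * y ≤ 17 := by rw [hℓ, one_mul]; linarith
  have hT0 : 0 < x ^ ((3 : ℝ) / 8) := Real.rpow_pos_of_pos hX0 _
  have hT1 : x ^ ((3 : ℝ) / 8) ≤ 1 := Real.rpow_le_one hX0.le hX1 (by norm_num)
  have hLj1 : (1 : ℝ) ≤ (F.L : ℝ) ^ j := one_le_pow₀ hL1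
  have hLcj1 : (1 : ℝ) ≤ (F.L : ℝ) ^ (c * j) := one_le_pow₀ hL1
  have hn1 : (n : ℝ) + 1 ≤ (C₁ + 1) * (F.L : ℝ) ^ (c * j) * ℓ := by
    have h1 : (1 : ℝ) ≤ (F.L : ℝ) ^ (c * j) * ℓ := by nlinarith
    have h2 : (n : ℝ) ≤ C₁ * (F.L : ℝ) ^ (c * j) * ℓ := by rw [hℓ, mul_one]; exact hnC
    nlinarith
  have hn0 : (0 : ℝ) ≤ (n : ℝ) + 1 := by positivity
  -- `β_K = x⁻¹` and the target unit `γ·L^(-(K-j)) = x·L^j`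
  have hβ : (F.scheme ℰp γ).β K = x⁻¹ := by
    simp only [hx, T3Family.scheme, Params.eps, T3Family.P, Literature.MathematicalPhysics.QuantumFieldTheory.Balaban1985CMP102.Setting.params3]
  have hxLj : γ * ((F.L : ℝ)⁻¹) ^ (K - j) = x * (F.L : ℝ) ^ j := by
    rw [hx, inv_pow, inv_pow, pow_sub₀ _ hL0.ne' hjK, mul_inv, inv_inv]; ring
  -- generic window lemma: `L^a · x^b ≤ 1` when `a ≤ K·b`
  have hwin : ∀ a b : ℕ, a ≤ K * b → (F.L : ℝ) ^ a * x ^ b ≤ 1 := by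
    intro a b hab
    calc (F.L : ℝ) ^ a * x ^ b ≤ (F.L : ℝ) ^ a * (((F.L : ℝ)⁻¹) ^ K) ^ b := by gcongr
    _ = (F.L : ℝ) ^ a / (F.L : ℝ) ^ (K * b) := by rw [← pow_mul, inv_pow, div_eq_mul_inv]
    _ ≤ 1 := by rw [div_le_one (by positivity)]; exact pow_le_pow_right₀ hL1 hab
  -- (W1) the Hessian window `L^{3cj}·y⁴ ≤ 1` (⇔ `L^{12cj}·x ≤ 1`, `12cj ≤ K`)
  have hW1 : (F.L : ℝ) ^ (3 * (c * j)) * y ^ 4 ≤ 1 := by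
    have h12 : 12 * (c * j) ≤ K * 1 := by
      have : (12 * c + 16) * j = 12 * (c * j) + 16 * j := by ring
      omega
    have hz0 : 0 ≤ (F.L : ℝ) ^ (3 * (c * j)) * y ^ 4 := by positivity
    rw [← pow_le_one_iff_of_nonneg hz0 (by norm_num : (4 : ℕ) ≠ 0)]
    rw [mul_pow, ← pow_mul, ← pow_mul, show 3 * (c * j) * 4 = 12 * (c * j) by ring, show (4 : ℕ) * 4 = 16 by norm_num, hy16,
      ← pow_one x]
    exact hwin _ _ h12
  -- (W2), (W3) the Peierls windows at order `M = c + 5`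
  have hW2 : (F.L : ℝ) ^ (4 * (c * j)) * x ^ (c + 3) ≤ 1 := by
    refine hwin _ _ ?_
    have := Nat.mul_le_mul (show 4 * c ≤ 4 * (c + 3) by omega) hjK
    nlinarith
  have hW3 : (F.L : ℝ) ^ (3 * (c * j)) * x ^ (c + 3) ≤ 1 := by
    refine hwin _ _ ?_
    have := Nat.mul_le_mul (show 3 * c ≤ 3 * (c + 3) by omega) hjK
    nlinarith
  -- the large-field tail (stub_peierls0 at order `M = c + 5`)
  have hm : (gibbsK F ℰp γ K).real {U | ¬ PlaqSmallOn (boxPlaqs lo hi) (x ^ ((3 : ℝ) / 8)) U} ≤ C₄ * ((n : ℝ) + 1) ^ 3 * x ^ (c + 5) :=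
    H4 F γ rfl hγ hγb' K lo hi n hbox hn
  have hm0 : 0 ≤ (gibbsK F ℰp γ K).real {U | ¬ PlaqSmallOn (boxPlaqs lo hi) (x ^ ((3 : ℝ) / 8)) U} := measureReal_nonneg
  -- the absorptions at `ℓ = 1` (formerly the log absorptions): `ℓ²·θ ≤ 289·y⁴`, `ℓ³·x^{c+5} ≤ 4913·x^{c+4}`
  have hA2 : ℓ ^ 2 * x ^ ((3 : ℝ) / 8) ≤ 289 * y ^ 4 := by
    rw [hθy]
    have : ℓ ^ 2 * y ^ 6 = (ℓ * y) ^ 2 * y ^ 4 := by ring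
    rw [this]
    have h := pow_le_pow_left₀ (by positivity) hℓy 2
    nlinarith [pow_nonneg hy0.le 4]
  have hA3 : ℓ ^ 3 * x ^ (c + 5) ≤ 4913 * x ^ (c + 4) := by
    have e : ℓ ^ 3 * x ^ (c + 5) = (ℓ * y) ^ 3 * y ^ 13 * x ^ (c + 4) := by
      rw [show c + 5 = (c + 4) + 1 by ring, pow_succ, ← hy16]; ring
    rw [e]
    have h := pow_le_pow_left₀ (by positivity) hℓy 3
    have hy13 : y ^ 13 ≤ 1 := pow_le_one₀ hy0.le hy1
    have hxc : 0 ≤ x ^ (c + 4) := by positivity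
    calc (ℓ * y) ^ 3 * y ^ 13 * x ^ (c + 4) ≤ 17 ^ 3 * 1 * x ^ (c + 4) := by gcongr
      _ = 4913 * x ^ (c + 4) := by norm_num
  -- per colour component α: SD identity, Hessian bound, arithmetic
  have hIY : ∀ α : Fin 3, ∫ U, (actionDeriv (fundamentalRep (Fin 2)) (u α) (GaugeField.gaugeAct (axialGauge U lo hi) U)) ^ 2 ∂(gibbsK F ℰp γ K)
      ≤ KH * (x * (F.L : ℝ) ^ j) := by
    intro α
    have hS0 : 0 ≤ ∑ b : PBond (F.P K) 0, ‖u α b‖ ^ 2 := by positivity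
    have hD0 : 0 ≤ ∑ p : Plaq (F.P K) 0, ‖u α (slotBond p 0) + u α (slotBond p 1) - u α (slotBond p 2) - u α (slotBond p 3)‖ ^ 2 := by
      positivity
    -- second-order Schwinger–Dyson: `∫ Y² = x · ∫ Hess`
    have hSD : ∫ U, (actionDeriv (fundamentalRep (Fin 2)) (u α) (GaugeField.gaugeAct (axialGauge U lo hi) U)) ^ 2 ∂(gibbsK F ℰp γ K) =
        x * ∫ U, actionDeriv₂ (fundamentalRep (Fin 2)) (u α) (GaugeField.gaugeAct (axialGauge U lo hi) U) ∂(gibbsK F ℰp γ K) := by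
      have h := h2 F γ hγ.le K lo hi n (u α) hbox hn (hsu α) (hsupp α)
      rw [hβ] at h
      have h' := congrArg (fun t : ℝ => x * t) h
      simpa only [← mul_assoc, mul_inv_cancel₀ hX0.ne', one_mul] using h'
    -- Hessian on/off the event at `θ = θ_K`
    have hH := H3 F γ hγ.le K lo hi n (u α) hbox hn (hsu α) (hsupp α) (x ^ ((3 : ℝ) / 8)) hT0
    -- (T2) small-field corrections: `(n+1)²(θ+θ²)Σ‖u‖² ≤ 578·C₁(C₁+1)²·L^j`
    have hT2 : ((n : ℝ) + 1) ^ 2 * (x ^ ((3 : ℝ) / 8) + (x ^ ((3 : ℝ) / 8)) ^ 2) * ∑ b : PBond (F.P K) 0, ‖u α b‖ ^ 2 ≤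
        578 * C₁ * (C₁ + 1) ^ 2 * (F.L : ℝ) ^ j := by
      have hθθ : x ^ ((3 : ℝ) / 8) + (x ^ ((3 : ℝ) / 8)) ^ 2 ≤ 2 * x ^ ((3 : ℝ) / 8) := by
        have h := mul_le_mul_of_nonneg_left hT1 hT0.le
        rw [mul_one, ← pow_two] at h; linarith
      calc ((n : ℝ) + 1) ^ 2 * (x ^ ((3 : ℝ) / 8) + (x ^ ((3 : ℝ) / 8)) ^ 2) * ∑ b : PBond (F.P K) 0, ‖u α b‖ ^ 2
          ≤ ((C₁ + 1) * (F.L : ℝ) ^ (c * j) * ℓ) ^ 2 * (2 * x ^ ((3 : ℝ) / 8)) * (C₁ * (F.L : ℝ) ^ (c * j)) := by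
            gcongr
            · exact hS α
      _ = 2 * C₁ * (C₁ + 1) ^ 2 * (F.L : ℝ) ^ (3 * (c * j)) * (ℓ ^ 2 * x ^ ((3 : ℝ) / 8)) := by
            have hp : (F.L : ℝ) ^ (3 * (c * j)) = (F.L : ℝ) ^ (c * j) * (F.L : ℝ) ^ (c * j) * (F.L : ℝ) ^ (c * j) := by
              rw [← pow_add, ← pow_add]; congr 1; ring
            rw [hp]; ring
      _ ≤ 2 * C₁ * (C₁ + 1) ^ 2 * (F.L : ℝ) ^ (3 * (c * j)) * (289 * y ^ 4) := by gcongr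
      _ = 578 * C₁ * (C₁ + 1) ^ 2 * ((F.L : ℝ) ^ (3 * (c * j)) * y ^ 4) := by ring
      _ ≤ 578 * C₁ * (C₁ + 1) ^ 2 * 1 := by gcongr
      _ ≤ 578 * C₁ * (C₁ + 1) ^ 2 * (F.L : ℝ) ^ j := by gcongr
    -- (T3) Hessian × tail: `Σ‖u‖²·tail ≤ 4913·C₁C₄(C₁+1)³·L^j`
    have hT3 : (∑ b : PBond (F.P K) 0, ‖u α b‖ ^ 2) * (gibbsK F ℰp γ K).real {U | ¬ PlaqSmallOn (boxPlaqs lo hi) (x ^ ((3 : ℝ) / 8)) U} ≤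
        4913 * C₁ * C₄ * (C₁ + 1) ^ 3 * (F.L : ℝ) ^ j := by
      calc (∑ b : PBond (F.P K) 0, ‖u α b‖ ^ 2) * (gibbsK F ℰp γ K).real {U | ¬ PlaqSmallOn (boxPlaqs lo hi) (x ^ ((3 : ℝ) / 8)) U}
          ≤ (C₁ * (F.L : ℝ) ^ (c * j)) * (C₄ * ((n : ℝ) + 1) ^ 3 * x ^ (c + 5)) := mul_le_mul (hS α) hm hm0 (by positivity)
        _ ≤ (C₁ * (F.L : ℝ) ^ (c * j)) * (C₄ * ((C₁ + 1) * (F.L : ℝ) ^ (c * j) * ℓ) ^ 3 * x ^ (c + 5)) := by gcongr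
        _ = C₁ * C₄ * (C₁ + 1) ^ 3 * (F.L : ℝ) ^ (4 * (c * j)) * (ℓ ^ 3 * x ^ (c + 5)) := by
            have hp : (F.L : ℝ) ^ (4 * (c * j)) = (F.L : ℝ) ^ (c * j) * ((F.L : ℝ) ^ (c * j)) ^ 3 := by
              rw [← pow_mul, ← pow_add]; congr 1; ring
            rw [hp]; ring
        _ ≤ C₁ * C₄ * (C₁ + 1) ^ 3 * (F.L : ℝ) ^ (4 * (c * j)) * (4913 * x ^ (c + 4)) := by gcongr
        _ = 4913 * C₁ * C₄ * (C₁ + 1) ^ 3 * x * ((F.L : ℝ) ^ (4 * (c * j)) * x ^ (c + 3)) := by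
            rw [show c + 4 = (c + 3) + 1 by ring, pow_succ]; ring
        _ ≤ 4913 * C₁ * C₄ * (C₁ + 1) ^ 3 * x * 1 := by gcongr
        _ ≤ 4913 * C₁ * C₄ * (C₁ + 1) ^ 3 * 1 * 1 := by gcongr
        _ ≤ 4913 * C₁ * C₄ * (C₁ + 1) ^ 3 * (F.L : ℝ) ^ j := by rw [mul_one, mul_one]; exact le_mul_of_one_le_right (by positivity) hLj1
    have hIH : ∫ U, actionDeriv₂ (fundamentalRep (Fin 2)) (u α) (GaugeField.gaugeAct (axialGauge U lo hi) U) ∂(gibbsK F ℰp γ K) ≤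
        KH * (F.L : ℝ) ^ j := by
      have e1 := mul_le_mul_of_nonneg_left (hD α) hC₃
      have e2 := mul_le_mul_of_nonneg_left hT2 hC₃
      have e3 := mul_le_mul_of_nonneg_left hT3 hC₃
      rw [hKH]
      nlinarith [hH, e1, e2, e3]
    rw [hSD]
    calc x * (∫ U, actionDeriv₂ (fundamentalRep (Fin 2)) (u α) (GaugeField.gaugeAct (axialGauge U lo hi) U) ∂(gibbsK F ℰp γ K))
        ≤ x * (KH * (F.L : ℝ) ^ j) := mul_le_mul_of_nonneg_left hIH hX0.le
      _ = KH * (x * (F.L : ℝ) ^ j) := by ring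
  -- sum over the three colour components
  have hsum : ∑ α : Fin 3, ∫ U, (actionDeriv (fundamentalRep (Fin 2)) (u α) (GaugeField.gaugeAct (axialGauge U lo hi) U)) ^ 2 ∂(gibbsK F ℰp γ K)
      ≤ 3 * (KH * (x * (F.L : ℝ) ^ j)) := by
    calc ∑ α : Fin 3, ∫ U, (actionDeriv (fundamentalRep (Fin 2)) (u α) (GaugeField.gaugeAct (axialGauge U lo hi) U)) ^ 2 ∂(gibbsK F ℰp γ K)
        ≤ ∑ α : Fin 3, KH * (x * (F.L : ℝ) ^ j) := Finset.sum_le_sum fun α _ => hIY α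
      _ = 3 * (KH * (x * (F.L : ℝ) ^ j)) := by
          simp only [Finset.sum_const, Finset.card_univ, Fintype.card_fin, nsmul_eq_mul, Nat.cast_ofNat]
  -- (T6) the weighted thin-rectangle row: `Σ_b ω_b·∫dist₁((VU) b)² ≤ C₅·C₁·(x·L^j)` by the folded floor
  have hT6 : ∑ b : PBond (F.P K) 0, ω b * ∫ U, (GaugeGroup.dist1 (GaugeField.gaugeAct (axialGauge U lo hi) U b)) ^ 2 ∂(gibbsK F ℰp γ K) ≤
      C₅ * C₁ * (x * (F.L : ℝ) ^ j) := by
    have hterm : ∀ b : PBond (F.P K) 0, ω b * ∫ U, (GaugeGroup.dist1 (GaugeField.gaugeAct (axialGauge U lo hi) U b)) ^ 2 ∂(gibbsK F ℰp γ K) ≤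
        ω b * (C₅ * n * ℓ * x) := by
      intro b
      by_cases hb : ω b = 0
      · rw [hb, zero_mul, zero_mul]
      · rw [hℓ, mul_one]; exact mul_le_mul_of_nonneg_left (H5 F γ rfl hγ hγc' K lo hi n hbox hn6 b (hωsupp b hb)) (hω0 b)
    calc ∑ b : PBond (F.P K) 0, ω b * ∫ U, (GaugeGroup.dist1 (GaugeField.gaugeAct (axialGauge U lo hi) U b)) ^ 2 ∂(gibbsK F ℰp γ K)
        ≤ ∑ b : PBond (F.P K) 0, ω b * (C₅ * n * ℓ * x) := Finset.sum_le_sum fun b _ => hterm b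
      _ = C₅ * x * ((n : ℝ) * ℓ * ∑ b : PBond (F.P K) 0, ω b) := by rw [← Finset.sum_mul]; ring
      _ ≤ C₅ * x * (C₁ * (F.L : ℝ) ^ j) := mul_le_mul_of_nonneg_left (by rw [hℓ, mul_one]; exact hfloor) (by positivity)
      _ = C₅ * C₁ * (x * (F.L : ℝ) ^ j) := by ring
  -- (T5) the bare tail term
  have hT5 : 4 * (gibbsK F ℰp γ K).real {U | ¬ PlaqSmallOn (boxPlaqs lo hi) (x ^ ((3 : ℝ) / 8)) U} ≤
      4 * (4913 * C₄ * (C₁ + 1) ^ 3) * (x * (F.L : ℝ) ^ j) := by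
    calc 4 * (gibbsK F ℰp γ K).real {U | ¬ PlaqSmallOn (boxPlaqs lo hi) (x ^ ((3 : ℝ) / 8)) U}
        ≤ 4 * (C₄ * ((n : ℝ) + 1) ^ 3 * x ^ (c + 5)) := by gcongr
      _ ≤ 4 * (C₄ * ((C₁ + 1) * (F.L : ℝ) ^ (c * j) * ℓ) ^ 3 * x ^ (c + 5)) := by gcongr
      _ = 4 * C₄ * (C₁ + 1) ^ 3 * (F.L : ℝ) ^ (3 * (c * j)) * (ℓ ^ 3 * x ^ (c + 5)) := by rw [pow_mul]; ring
      _ ≤ 4 * C₄ * (C₁ + 1) ^ 3 * (F.L : ℝ) ^ (3 * (c * j)) * (4913 * x ^ (c + 4)) := by gcongr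
      _ = 4 * (4913 * C₄ * (C₁ + 1) ^ 3) * x * ((F.L : ℝ) ^ (3 * (c * j)) * x ^ (c + 3)) := by
          rw [show c + 4 = (c + 3) + 1 by ring, pow_succ]; ring
      _ ≤ 4 * (4913 * C₄ * (C₁ + 1) ^ 3) * x * 1 := by gcongr
      _ ≤ 4 * (4913 * C₄ * (C₁ + 1) ^ 3) * (x * (F.L : ℝ) ^ j) := by
          rw [mul_one]
          exact mul_le_mul_of_nonneg_left (le_mul_of_one_le_right hX0.le hLj1) (by positivity)
  -- assemble
  have hC₁sum := mul_le_mul_of_nonneg_left hsum hC₁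
  rw [horient]
  calc _ ≤ _ := hlin
    _ ≤ C₁ * (3 * (KH * (x * (F.L : ℝ) ^ j))) + C₅ * C₁ * (x * (F.L : ℝ) ^ j) + C₁ * (x * (F.L : ℝ) ^ j) +
          4 * (4913 * C₄ * (C₁ + 1) ^ 3) * (x * (F.L : ℝ) ^ j) := by
        rw [hxLj]; linarith [hC₁sum, hT5, hT6]
    _ = (3 * C₁ * KH + C₅ * C₁ + C₁ + 4 * (4913 * C₄ * (C₁ + 1) ^ 3)) * (γ * ((F.L : ℝ)⁻¹) ^ (K - j)) := by rw [hxLj]; ring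

/-- ★★★ THE SIX STUBS, BY NAME ⇒ «ShallowFluxSecondMomentL» (the window text). [cite: GrossCMP1983, Thm 2.2] -/
theorem shallowFluxSecondMomentL_of_stubs :
    ∀ (L : ℕ), ∃ N₁ : ℕ, 0 < N₁ ∧ ∃ C : ℝ, 0 ≤ C ∧ ∃ γ₁ : ℝ, 0 < γ₁ ∧ γ₁ ≤ 1 ∧
          ∀ (F : T3Family) (γ : ℝ), F.L = L → 0 < γ → γ ≤ γ₁ → ∀ (K j : ℕ), 1 ≤ j → N₁ * j ≤ K →
            ∀ a : Plaq (F.P K) j,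
              ∫ U, (GaugeGroup.dist1 (GaugeField.plaqHol
                  (Averaging.iter (fun i' => BlockAveraging.blockAvg (P := F.P K) (j := i') ℰp) j U) a)) ^ 2 ∂(gibbsK F ℰp γ K)
                ≤ C * (γ * ((F.L : ℝ)⁻¹) ^ (K - j)) :=
  shallowFluxSecondMomentL_of stub_linTest stub_condSD stub_hessOnEvent stub_peierls0 stub_thinRect stub_orient

/-- ★★ THE FOUR STUBS, BY NAME ⇒ `RevelationMartingale.MeanDeviationShallowL` (stmt-QuantumFields-23133's decl, via ✓p733394). [cite: Balaban1985UV3, (7) p.257] -/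
theorem meanDeviationShallowL_of_stubs :
    Summit.QuantumFields.YangMills.Theses.RevelationMartingale.MeanDeviationShallowL :=
  meanDeviationShallowL_of_shallowSecondMoment shallowFluxSecondMomentL_of_stubs

/-! ## §3 The residual, imported VERBATIM and BY NAME as the fifth stub (organ-adjacent; NOT this line's mechanism) -/

/-- **stub_meanDeviationDeep (XL, RESIDUAL, organ-adjacent — HONESTLY NOT this line's mechanism).**  The OPEN crux `RevelationMartingale.MeanDeviationDeepL`
(stmt-QuantumFields-23134, rank 302: the mean deviation on the deep window `K < N₁·j`, for every `N₁`) imported BY NAME, exactly as LINE 24 imports `SandwichDeep`: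
it is the other half of the registered split of stmt-QuantumFields-23083 (glue ✓`revelationMartingale_meanDeviationLGlue_proof`).  WHY IT MIGHT FAIL: it is the
UV-stability-in-mean statement at ALL deep scales (Bałaban's inductive renormalisation; catalogued barrier B-α: chessboard alone stalls at depth (2/3)log_L p).
Sources: [Balaban1985UV3] (7) p.257 and (71) p.273; route file `Theses/RevelationMartingale.lean` (item 23134). -/
theorem stub_meanDeviationDeep : Summit.QuantumFields.YangMills.Theses.RevelationMartingale.MeanDeviationDeepL := by
  sorry

/-! ## §4 The line's conclusion BY NAME -/

/-- ★★★ **THE LINE'S CONCLUSION BY NAME (sorry-free modulo the five named stubs): `RevelationMartingale.MeanDeviationL` = stmt-QuantumFields-23083.**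
Four GrossTransfer stubs ⇒ window second moment ⇒ `MeanDeviationShallowL` (✓p733394); with the residual stub `stub_meanDeviationDeep` ⇒ `MeanDeviationL`
(✓`meanDeviationL_of_shallowSecondMoment_deep`). [cite: Balaban1985UV3, (7) p.257 and (71) p.273] -/
theorem MeanDeviationL_of_stubs : Summit.QuantumFields.YangMills.Theses.RevelationMartingale.MeanDeviationL :=
  meanDeviationL_of_shallowSecondMoment_deep shallowFluxSecondMomentL_of_stubs stub_meanDeviationDeep

/-- ★★ The same conclusion in the `Theses.PoincareLipschitz` spelling of the shared item stmt-QuantumFields-23083. [cite: Balaban1985UV3, (7) p.257 and (71) p.273] -/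
theorem MeanDeviationL_of_stubs' : Summit.QuantumFields.YangMills.Theses.PoincareLipschitz.MeanDeviationL :=
  meanDeviationL_of_shallowSecondMoment_deep' shallowFluxSecondMomentL_of_stubs stub_meanDeviationDeep

end Summit.QuantumFields.YangMills.Cruxes.HistoryTailL.GrossTransfer
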